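import Summits.QuantumAdvantage.QuantumAdvantage.Theorems.LinnikCubicClassGroupsDegreeOnePrimesEscapeClassPNTOfDensity
import Summits.QuantumAdvantage.QuantumAdvantage.Theorems.LinnikCubicClassGroupsDegreeOnePrimesEscapeClassPNTFamilyDensity
import Summits.QuantumAdvantage.QuantumAdvantage.Theorems.LinnikCubicClassGroupsDegreeOnePrimesEscapeResidueAllFields
import HarnessLib

/-!
# The additive class prime number theorem for EVERY number field of a given degree
# (no residue hypothesis, no subfield hypothesis)

Topic `Summits/QuantumAdvantage/QuantumAdvantage/Theorems`, cell B2b-1 (linnik-cubic): PART B (seat 4) assembling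
PART A's degree-local additive class PNT (`classPNTAdditive_of_famDensity`, file VII of A's chain, fed by the family
density `fam_density_local` in `Q`-form, which carries the residue hypothesis `condQn K ^ (−A) ≤ κ_K`) with the
all-fields residue bound `Residue.residueLowerBound_all` (class number formula + kernel-checked regulator lower bound,
`…ResidueAllFields.lean` ← Literature `DedekindResidueCondQnLowerBound.lean`).  Crux `DegreeOnePrimesEscape`
(stmt-QuantumAdvantage-11543); this is the registered stub `stub_classPNTAdditive` of line `dedekind-s3-collision` in
DEGREE-LOCAL form (the registered ∀-degree form asks for ONE exponent `c₁` for all degrees, which the tree's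
degree-dependent density constants do not give).

HONEST FRAMING: the value of this file is a THEOREM — Thorner–Zaman 2019 Thm 1.4 (Hilbert class field case) MINUS
the Deuring–Heilbronn factor, with additive error `Li(x)/(32 h_K)`, the exceptional zero kept, for every number field
of each fixed degree `n > 1`; GRH-free, Siegel-free, no hypothesis on quadratic subfields — NOT summit progress.

## References
* J. Thorner, A. Zaman, *A unified and improved Chebotarev density theorem*, Algebra & Number Theory 13 (2019)
  1039–1068, Thm. 1.4 and Thm. 3.2 (arXiv:1803.02823, pp. 3 and 9). [ThornerZaman2019]
-/

noncomputable section

open scoped NumberField nonZeroDivisors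
open Literature.NumberTheory.LFunctions Literature.NumberTheory.LFunctions.NumberField
  Literature.NumberTheory.LFunctions.AbelianDensity

namespace Summit.QuantumAdvantage.QuantumAdvantage.Theorems.DegreeOnePrimesEscape

/-- **The additive class prime number theorem, EVERY number field of degree `n > 1`.**  There is
`c₁ = c₁(n) > 0` such that for every number field `K` of degree `n` (`Q = |d_K| n^n`, `h = h_K`): EITHER
`|π_C(x) − Li(x)/h| ≤ Li(x)/(32h)` for all ideal classes `C` and all `x ≥ Q^{c₁}`, OR there is a real class-group
character `χ₁` with a real zero `β₁ ∈ (1 − 1/(8 log Q), 1)` of `L(s, χ₁)` (of `ζ_K` if `χ₁ = 1`) and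
`|π_C(x) − (Li(x) − Re χ₁(C) · Li(x^{β₁}))/h| ≤ Li(x)/(32h)` for all `C` and all `x ≥ Q^{c₁}`.
(PART A's `classPNTAdditive_of_famDensity` + `fam_density_local` at `A = A(n)` from PART B's
`Residue.residueLowerBound_all`.)  No GRH, no Siegel-type hypothesis, no hypothesis on subfields. -/
theorem classPNTAdditive_allFields (n : ℕ) (hn : 1 < n) :
    ∃ c₁ : ℝ, 0 < c₁ ∧ ∀ (K : Type) [Field K] [NumberField K], Module.finrank ℚ K = n →
      ((∀ (C : ClassGroup (𝓞 K)) (x : ℝ), ThornerZaman.condQn K ^ c₁ ≤ x →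
          |(primeIdealClassCount K C x : ℝ) - offsetLogIntegral x / NumberField.classNumber K| ≤
            offsetLogIntegral x / (32 * NumberField.classNumber K)) ∨
        ∃ (χ₁ : ClassGroup (𝓞 K) →* ℂˣ) (β₁ : ℝ), χ₁ * χ₁ = 1 ∧
          1 - 1 / (8 * Real.log (ThornerZaman.condQn K)) < β₁ ∧ β₁ < 1 ∧
          classGroupLFunction K χ₁ β₁ = 0 ∧
          ∀ (C : ClassGroup (𝓞 K)) (x : ℝ), ThornerZaman.condQn K ^ c₁ ≤ x →
            |(primeIdealClassCount K C x : ℝ) -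
                (offsetLogIntegral x - ((χ₁ C : ℂ)).re * offsetLogIntegral (x ^ β₁)) /
                  NumberField.classNumber K| ≤
              offsetLogIntegral x / (32 * NumberField.classNumber K)) := by
  obtain ⟨A, -, hA⟩ := Residue.residueLowerBound_all n
  obtain ⟨b, D, hb, hD, hfam⟩ := fam_density_local n hn A
  obtain ⟨c₁, hc₁, h⟩ := classPNTAdditive_of_famDensity n hn hb hD (a := max A 4)
    (le_trans (by norm_num) (le_max_right _ _))
  exact ⟨c₁, hc₁, fun K _ _ hK => h K hK (fun T hT u hu α hα => hfam K hK (hA K hK) T hT u hu α hα)⟩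

/-- **The cubic slice (cell B2b-1's literal brief, `ClassPNTAdditive(3)`)**: the additive class PNT dichotomy for
EVERY cubic number field, unconditionally. -/
theorem classPNTAdditive_allCubicFields :
    ∃ c₁ : ℝ, 0 < c₁ ∧ ∀ (K : Type) [Field K] [NumberField K], Module.finrank ℚ K = 3 →
      ((∀ (C : ClassGroup (𝓞 K)) (x : ℝ), ThornerZaman.condQn K ^ c₁ ≤ x →
          |(primeIdealClassCount K C x : ℝ) - offsetLogIntegral x / NumberField.classNumber K| ≤
            offsetLogIntegral x / (32 * NumberField.classNumber K)) ∨
        ∃ (χ₁ : ClassGroup (𝓞 K) →* ℂˣ) (β₁ : ℝ), χ₁ * χ₁ = 1 ∧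
          1 - 1 / (8 * Real.log (ThornerZaman.condQn K)) < β₁ ∧ β₁ < 1 ∧
          classGroupLFunction K χ₁ β₁ = 0 ∧
          ∀ (C : ClassGroup (𝓞 K)) (x : ℝ), ThornerZaman.condQn K ^ c₁ ≤ x →
            |(primeIdealClassCount K C x : ℝ) -
                (offsetLogIntegral x - ((χ₁ C : ℂ)).re * offsetLogIntegral (x ^ β₁)) /
                  NumberField.classNumber K| ≤
              offsetLogIntegral x / (32 * NumberField.classNumber K)) :=
  classPNTAdditive_allFields 3 (by norm_num)

end Summit.QuantumAdvantage.QuantumAdvantage.Theorems.DegreeOnePrimesEscape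

end
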